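import Mathlib
import HarnessLib
import Literature.Probability.MarkovChains.MetropolisHastings
import Literature.Probability.MarkovChains.TotalVariation

/-!
# The pseudo-marginal Metropolis–Hastings algorithm on a finite state space: exactness

HONEST FRAMING: exact (Metropolis-corrected) sampling algorithms for lattice gauge theory;
figures of merit are autocorrelation/cost numbers at stated couplings and volumes; no
continuum-physics claim.

Setting (finite form).  `X` is a finite state space with a positive target weight `π : X → ℝ`
that can NOT be evaluated, and `Ξ` a finite space of auxiliary ("noise") variables with a
positive law `g : Ξ → ℝ`; `f : X → Ξ → ℝ`, positive, is an UNBIASED ESTIMATOR of the target: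
`Σ_ξ g ξ · f x ξ = π x`.  The pseudo-marginal algorithm (Beaumont 2003; Andrieu–Roberts 2009)
runs Metropolis–Hastings with the estimate in place of the target: from `(x, ξ)` propose
`x' ∼ T x ·` and a FRESH `ξ' ∼ g`, accept with probability
`min {1, f x' ξ' · T x' x / (f x ξ · T x x')}` — the current state's estimate `f x ξ` is the one
computed when `x` was accepted (it is RECYCLED, not re-drawn).  The printed theorem: this is an
ordinary Metropolis–Hastings chain on the EXTENDED space `X × Ξ` whose invariant density is
`∝ g ξ · f x ξ` ("λ · m(θ) · g(λ|θ)"), and the `X`-marginal of that density is `π`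
[cite: AndrieuRoberts2009, §1–§2 (the pseudo-marginal approach; Theorem 1)];
[cite: LlorenteEtAl2024NoisyMC, §3 Thm 1 and Appendix "Proof for noisy MH algorithm" (the
invariant density is proportional to `λ·m(θ)·g(λ|θ)`, whose marginal is `∝ m(θ)`)].  The
lattice-QCD form with a stochastic fermion-determinant estimator is [cite: AlbergoEtAl2021Fermions,
§III.A ("This estimate of p(ϕ) is then used in all subsequent accept/reject tests")]; the
two-step variant — update `x` at fixed `ξ`, then refresh `ξ` at fixed `x`, each with its own
Metropolis test — is the (Kentucky) noisy Monte Carlo of [cite: LinLiuSloan2000, §II eqs. (met1),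
(met2) and the detailed-balance computation following them ("completely unbiased")].

Everything below is an INSTANCE of the tree's `mhKernel_detailedBalance` /
`mhKernel_isStationary` (file `MetropolisHastings.lean`) on the product type `X × Ξ`, plus the
one-line marginalisation; the only content specific to the pseudo-marginal method is the
identity `rate_eq` (the auxiliary law `g` CANCELS from the Hastings ratio, so the chain never
evaluates `π` or `g`, only `f` and `T`).

Results (all proved, finite sums):
* `PseudoMarginal.rate_eq` — the Hastings rate on `X × Ξ` for proposal `T x x' · g ξ'` and weight
  `g ξ · f x ξ` equals `g ξ' · min (T x x') (f x' ξ' · T x' x / f x ξ)` (the algorithm as run);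
* `PseudoMarginal.kernel_detailedBalance`, `kernel_isStationary`, `kernel_isRowStochastic` —
  exactness on the extended space for EVERY proposal matrix `T` and every positive `f`, `g`;
* `PseudoMarginal.sum_target`, `sum_target_mul` — under unbiasedness the `X`-marginal of the
  invariant weight is `π`, hence `π`-expectations of observables of `x` are reproduced;
* `PseudoMarginal.TwoStep.*` — the same for the two partial moves of the noisy Monte Carlo
  algorithm and for their composition (`stepLaw_comp_eq`);
* `PseudoMarginal.Signed.*` (appended 2026-08-21) — SIGNED estimators: `f = sign(f)|f|`
  (eq. (sign)), the chain runs on the semi-positive weight `g ξ |f x ξ|` (eq. (Znew); exact: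
  `Signed.abs_exact`) and `⟨O⟩_π = ⟨O sign(f)⟩_{|f|} / ⟨sign(f)⟩_{|f|}` (eq. (Onew),
  `Signed.sign_reweighting`, with the numerator/denominator identities and `|Σ π| ≤ Z_{|f|}`).

Deliberately NOT here: general (non-finite) state spaces (the printed results are stated for
general spaces) — TODO(general form): Markov kernels on measurable spaces.  Not here either: any
statement about the FRESH-noise variant ("Monte Carlo within Metropolis"), which is NOT this
algorithm and is not exact in general
[cite: AlbergoEtAl2021Fermions, §III.A footnote ("asymptotic exactness has not been
demonstrated")] — a finite counterexample is cell work under `Summits/Ventures/LatticeQCDFlow/`.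

Context: cell pub-lqcd (venture LatticeQCDFlow), R2-SCOPE.md §3 E2 routes D2/D3, E3 (sign), §5 controls
V-4a / V-4d.
-/

namespace Literature.Probability.MarkovChains

open Finset

-- Grouping namespace for the pseudo-marginal construction (names the algorithm).
namespace PseudoMarginal

variable {X Ξ : Type*} [Fintype X] [Fintype Ξ] [DecidableEq X] [DecidableEq Ξ]

/-- The extended ("pseudo-marginal") target weight on `X × Ξ`: `(x, ξ) ↦ g ξ · f x ξ` — the noise
law times the estimate.  [cite: AndrieuRoberts2009, §1–§2];
[cite: LlorenteEtAl2024NoisyMC, Appendix "Proof for noisy MH algorithm" (`λ·m(θ)·g(λ|θ)`)] -/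
def target (f : X → Ξ → ℝ) (g : Ξ → ℝ) : X × Ξ → ℝ := fun z => g z.2 * f z.1 z.2

/-- The pseudo-marginal proposal on `X × Ξ`: move `x ↦ x'` with the user's proposal matrix `T` and
draw a FRESH auxiliary variable `ξ' ∼ g`, independently of the current `ξ`.
[cite: LlorenteEtAl2024NoisyMC, Appendix (`q_equiv(θ, λ | θ', λ') = g(λ|θ) φ(θ|θ')`)] -/
def proposal (T : X → X → ℝ) (g : Ξ → ℝ) : X × Ξ → X × Ξ → ℝ := fun z z' => T z.1 z'.1 * g z'.2

/-- The pseudo-marginal kernel = the Metropolis–Hastings kernel on the extended space for the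
proposal `proposal T g` and the weight `target f g`. [cite: AndrieuRoberts2009, §1–§2] -/
noncomputable def kernel (T : X → X → ℝ) (f : X → Ξ → ℝ) (g : Ξ → ℝ) : X × Ξ → X × Ξ → ℝ :=
  mhKernel (proposal T g) (target f g)

omit [Fintype X] [Fintype Ξ] [DecidableEq X] [DecidableEq Ξ] in
/-- The extended target is positive when the estimator and the noise law are (private helper).
[folklore] -/
private theorem target_pos {f : X → Ξ → ℝ} {g : Ξ → ℝ} (hf : ∀ x ξ, 0 < f x ξ) (hg : ∀ ξ, 0 < g ξ)
    (z : X × Ξ) : 0 < target f g z :=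
  mul_pos (hg z.2) (hf z.1 z.2)

omit [Fintype X] [Fintype Ξ] [DecidableEq X] [DecidableEq Ξ] in
/-- **The algorithm as run.**  The Hastings rate of the extended chain is
`g ξ' · min (T x x') (f x' ξ' · T x' x / f x ξ)`: the proposal draws `ξ' ∼ g`, and the
acceptance uses ONLY the estimates `f` (the recycled `f x ξ` for the current state, the fresh
`f x' ξ'` for the candidate) and `T` — the noise law `g` and the target `π` cancel.
[cite: LlorenteEtAl2024NoisyMC, Appendix (the acceptance ratio `r(θ_{t-1}, θ_prop)`)];
[cite: AlbergoEtAl2021Fermions, §III.A] -/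
theorem rate_eq {f : X → Ξ → ℝ} {g : Ξ → ℝ} (hf : ∀ x ξ, 0 < f x ξ) (hg : ∀ ξ, 0 < g ξ)
    (T : X → X → ℝ) (x x' : X) (ξ ξ' : Ξ) :
    mhRate (proposal T g) (target f g) (x, ξ) (x', ξ') =
      g ξ' * min (T x x') (f x' ξ' * T x' x / f x ξ) := by
  show min (T x x' * g ξ') (g ξ' * f x' ξ' * (T x' x * g ξ) / (g ξ * f x ξ)) = _
  rw [(monotone_mul_left_of_nonneg (hg ξ').le).map_min]
  have hgξ : g ξ ≠ 0 := (hg ξ).ne'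
  have hfx : f x ξ ≠ 0 := (hf x ξ).ne'
  congr 1
  · ring
  · field_simp

/-- **Exactness (detailed balance) of the pseudo-marginal chain** on the extended space, for
EVERY proposal matrix `T` and every positive estimator `f` and noise law `g`.
[cite: AndrieuRoberts2009, Theorem 1 / §2]; [cite: LlorenteEtAl2024NoisyMC, §3 Thm 1 + Appendix] -/
theorem kernel_detailedBalance {f : X → Ξ → ℝ} {g : Ξ → ℝ} (hf : ∀ x ξ, 0 < f x ξ)
    (hg : ∀ ξ, 0 < g ξ) (T : X → X → ℝ) : DetailedBalance (target f g) (kernel T f g) :=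
  mhKernel_detailedBalance (target_pos hf hg) _

/-- **Exactness (stationarity)**: the extended weight `g ξ · f x ξ` is stationary for the
pseudo-marginal chain. [cite: AndrieuRoberts2009, Theorem 1 / §2];
[cite: LlorenteEtAl2024NoisyMC, Appendix ("the invariant density is proportional to
λ·m(θ)·g(λ|θ)")] -/
theorem kernel_isStationary {f : X → Ξ → ℝ} {g : Ξ → ℝ} (hf : ∀ x ξ, 0 < f x ξ)
    (hg : ∀ ξ, 0 < g ξ) (T : X → X → ℝ) : IsStationary (target f g) (kernel T f g) :=
  mhKernel_isStationary (target_pos hf hg) _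

/-- The pseudo-marginal kernel is a stochastic (Markov) matrix when `T` is non-negative with row
sums `≤ 1` and `g` is a probability vector — it is a Metropolis–Hastings matrix.
[cite: GubernatisKawashimaWerner2016, §2.5.1 (stochasticity of the Metropolis–Hastings matrix)];
[cite: AndrieuRoberts2009, §1–§2 (the pseudo-marginal chain is a Metropolis–Hastings chain on the
extended space)] -/
theorem kernel_isRowStochastic {f : X → Ξ → ℝ} {g : Ξ → ℝ} (hf : ∀ x ξ, 0 < f x ξ)
    (hg : ∀ ξ, 0 < g ξ) (hg1 : ∑ ξ, g ξ = 1) {T : X → X → ℝ} (hT : ∀ x y, 0 ≤ T x y)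
    (hTrow : ∀ x, ∑ y, T x y ≤ 1) : IsRowStochastic (kernel T f g) := by
  refine mhKernel_isRowStochastic (fun z z' => mul_nonneg (hT z.1 z'.1) (hg z'.2).le) ?_
    (target_pos hf hg)
  intro z
  rw [Fintype.sum_prod_type]
  show ∑ x', ∑ ξ', T z.1 x' * g ξ' ≤ 1
  rw [← sum_mul_sum, hg1, mul_one]
  exact hTrow z.1

omit [Fintype X] [DecidableEq X] [DecidableEq Ξ] in
/-- **Unbiasedness ⇒ correct marginal.**  If `f` is an unbiased estimator of `π` under the noise
law `g` (`Σ_ξ g ξ · f x ξ = π x`), the `X`-marginal of the extended target is `π`.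
[cite: AndrieuRoberts2009, §1–§2]; [cite: LlorenteEtAl2024NoisyMC, Appendix ("whose marginal is
∫ λ m(θ) g(λ|θ) dλ ∝ m(θ)")] -/
theorem sum_target {f : X → Ξ → ℝ} {g : Ξ → ℝ} {π : X → ℝ}
    (hunb : ∀ x, ∑ ξ, g ξ * f x ξ = π x) (x : X) : ∑ ξ, target f g (x, ξ) = π x :=
  hunb x

omit [DecidableEq X] [DecidableEq Ξ] in
/-- Consequently expectations of observables of `x` under the extended invariant weight are the
`π`-expectations: `Σ_{(x,ξ)} g ξ f x ξ · O x = Σ_x π x · O x`. [cite: AndrieuRoberts2009, §1–§2];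
[cite: LlorenteEtAl2024NoisyMC, §3 Thm 1] -/
theorem sum_target_mul {f : X → Ξ → ℝ} {g : Ξ → ℝ} {π : X → ℝ}
    (hunb : ∀ x, ∑ ξ, g ξ * f x ξ = π x) (O : X → ℝ) :
    ∑ z : X × Ξ, target f g z * O z.1 = ∑ x, π x * O x := by
  rw [Fintype.sum_prod_type]
  refine sum_congr rfl fun x _ => ?_
  show ∑ ξ, g ξ * f x ξ * O x = π x * O x
  rw [← sum_mul, hunb x]

omit [DecidableEq X] [DecidableEq Ξ] in
/-- The total mass of the extended target is that of `π` (so normalisations agree).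
[cite: AndrieuRoberts2009, §1–§2] -/
theorem sum_target_univ {f : X → Ξ → ℝ} {g : Ξ → ℝ} {π : X → ℝ}
    (hunb : ∀ x, ∑ ξ, g ξ * f x ξ = π x) : ∑ z : X × Ξ, target f g z = ∑ x, π x := by
  simpa using sum_target_mul hunb fun _ => (1 : ℝ)

/-- **Pseudo-marginal exactness, packaged**: for every proposal matrix `T`, the pseudo-marginal
chain built from a positive unbiased estimator `f` of `π` (noise law `g`) has a stationary weight
on `X × Ξ` (namely `g ξ · f x ξ`) whose `X`-marginal is exactly `π` — the noise costs efficiency,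
never exactness. [cite: AndrieuRoberts2009, Theorem 1]; [cite: LlorenteEtAl2024NoisyMC, §3 Thm 1];
[cite: AlbergoEtAl2021Fermions, §III.A] -/
theorem exact {f : X → Ξ → ℝ} {g : Ξ → ℝ} {π : X → ℝ} (hf : ∀ x ξ, 0 < f x ξ)
    (hg : ∀ ξ, 0 < g ξ) (hunb : ∀ x, ∑ ξ, g ξ * f x ξ = π x) (T : X → X → ℝ) :
    IsStationary (target f g) (kernel T f g) ∧ ∀ x, ∑ ξ, target f g (x, ξ) = π x :=
  ⟨kernel_isStationary hf hg T, sum_target hunb⟩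

/-! ## The two-step (Kentucky noisy Monte Carlo) variant

[cite: LinLiuSloan2000, §II]: "two accept/reject steps are needed in general. The first one is to
propose updating of `U` via some procedure while keeping the stochastic variables `ξ` fixed … The
second accept/reject step involves the refreshing of the stochastic variables `ξ` according to
the probability distribution `P_ξ(ξ)` while keeping `U` fixed", with acceptances
`min(1, f(U₂,ξ)/f(U₁,ξ))` (eq. (met1), symmetric proposal) and `min(1, f(U,ξ₂)/f(U,ξ₁))`
(eq. (met2)); "Detailed balance can be proven to be satisfied … this new algorithm does preserve
detailed balance and is completely unbiased."  Both moves are Metropolis–Hastings kernels on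
`X × Ξ` for the SAME weight `g ξ · f x ξ`, hence each is in detailed balance with it and their
composition leaves it invariant. -/

namespace TwoStep

/-- Proposal of the first move: `x ↦ x'` by `T`, auxiliary variable kept (`ξ' = ξ`).
[cite: LinLiuSloan2000, §II eq. (met1)] -/
def proposalU (T : X → X → ℝ) : X × Ξ → X × Ξ → ℝ :=
  fun z z' => if z'.2 = z.2 then T z.1 z'.1 else 0

/-- Proposal of the second move: refresh `ξ' ∼ g`, state kept (`x' = x`).
[cite: LinLiuSloan2000, §II eq. (met2)] -/
def proposalXi (g : Ξ → ℝ) : X × Ξ → X × Ξ → ℝ :=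
  fun z z' => if z'.1 = z.1 then g z'.2 else 0

/-- First move of the noisy Monte Carlo algorithm as a Metropolis–Hastings kernel on `X × Ξ`.
[cite: LinLiuSloan2000, §II eq. (met1)] -/
noncomputable def kernelU (T : X → X → ℝ) (f : X → Ξ → ℝ) (g : Ξ → ℝ) :
    X × Ξ → X × Ξ → ℝ :=
  mhKernel (proposalU T) (target f g)

/-- Second move of the noisy Monte Carlo algorithm as a Metropolis–Hastings kernel on `X × Ξ`.
[cite: LinLiuSloan2000, §II eq. (met2)] -/
noncomputable def kernelXi (f : X → Ξ → ℝ) (g : Ξ → ℝ) : X × Ξ → X × Ξ → ℝ :=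
  mhKernel (proposalXi g) (target f g)

omit [Fintype X] [Fintype Ξ] [DecidableEq X] in
/-- The first move's Hastings rate at fixed noise `ξ`: `min (T x x') (f x' ξ · T x' x / f x ξ)` —
for a symmetric `T` this is `T x x' · min(1, f(x',ξ)/f(x,ξ))`, eq. (met1); the noise law does not
enter. [cite: LinLiuSloan2000, §II eq. (met1)] -/
theorem rateU_eq {f : X → Ξ → ℝ} {g : Ξ → ℝ} (hf : ∀ x ξ, 0 < f x ξ) (hg : ∀ ξ, 0 < g ξ)
    (T : X → X → ℝ) (x x' : X) (ξ : Ξ) :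
    mhRate (proposalU T) (target f g) (x, ξ) (x', ξ) = min (T x x') (f x' ξ * T x' x / f x ξ) := by
  show min (if ξ = ξ then T x x' else 0)
      (g ξ * f x' ξ * (if ξ = ξ then T x' x else 0) / (g ξ * f x ξ)) = _
  rw [if_pos rfl, if_pos rfl]
  have hgξ : g ξ ≠ 0 := (hg ξ).ne'
  have hfx : f x ξ ≠ 0 := (hf x ξ).ne'
  congr 1
  field_simp

omit [Fintype X] [Fintype Ξ] [DecidableEq Ξ] in
/-- The second move's Hastings rate at fixed state `x`: `g ξ' · min 1 (f x ξ' / f x ξ)` — refresh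
the noise from its law and accept with `min(1, f(x,ξ₂)/f(x,ξ₁))`, eq. (met2).
[cite: LinLiuSloan2000, §II eq. (met2)] -/
theorem rateXi_eq {f : X → Ξ → ℝ} {g : Ξ → ℝ} (hf : ∀ x ξ, 0 < f x ξ) (hg : ∀ ξ, 0 < g ξ)
    (x : X) (ξ ξ' : Ξ) :
    mhRate (proposalXi g) (target f g) (x, ξ) (x, ξ') = g ξ' * min 1 (f x ξ' / f x ξ) := by
  show min (if x = x then g ξ' else 0)
      (g ξ' * f x ξ' * (if x = x then g ξ else 0) / (g ξ * f x ξ)) = _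
  rw [if_pos rfl, if_pos rfl, (monotone_mul_left_of_nonneg (hg ξ').le).map_min, mul_one]
  have hgξ : g ξ ≠ 0 := (hg ξ).ne'
  have hfx : f x ξ ≠ 0 := (hf x ξ).ne'
  congr 1
  field_simp

/-- Detailed balance of the first move w.r.t. the extended weight.
[cite: LinLiuSloan2000, §II (first detailed-balance display)] -/
theorem kernelU_detailedBalance {f : X → Ξ → ℝ} {g : Ξ → ℝ} (hf : ∀ x ξ, 0 < f x ξ)
    (hg : ∀ ξ, 0 < g ξ) (T : X → X → ℝ) : DetailedBalance (target f g) (kernelU T f g) :=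
  mhKernel_detailedBalance (target_pos hf hg) _

/-- Detailed balance of the second move w.r.t. the extended weight.
[cite: LinLiuSloan2000, §II (second detailed-balance display)] -/
theorem kernelXi_detailedBalance {f : X → Ξ → ℝ} {g : Ξ → ℝ} (hf : ∀ x ξ, 0 < f x ξ)
    (hg : ∀ ξ, 0 < g ξ) : DetailedBalance (target f g) (kernelXi f g) :=
  mhKernel_detailedBalance (target_pos hf hg) _

/-- Stationarity of the extended weight for the first move. [cite: LinLiuSloan2000, §II] -/
theorem kernelU_isStationary {f : X → Ξ → ℝ} {g : Ξ → ℝ} (hf : ∀ x ξ, 0 < f x ξ)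
    (hg : ∀ ξ, 0 < g ξ) (T : X → X → ℝ) : IsStationary (target f g) (kernelU T f g) :=
  mhKernel_isStationary (target_pos hf hg) _

/-- Stationarity of the extended weight for the second move. [cite: LinLiuSloan2000, §II] -/
theorem kernelXi_isStationary {f : X → Ξ → ℝ} {g : Ξ → ℝ} (hf : ∀ x ξ, 0 < f x ξ)
    (hg : ∀ ξ, 0 < g ξ) : IsStationary (target f g) (kernelXi f g) :=
  mhKernel_isStationary (target_pos hf hg) _

end TwoStep

/-- Composition of two kernels that both leave `π` stationary leaves `π` stationary (one sweep =
first kernel then second; private helper). [folklore] -/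
private theorem stepLaw_comp_eq {Y : Type*} [Fintype Y] {π : Y → ℝ} {P Q : Y → Y → ℝ}
    (hP : IsStationary π P) (hQ : IsStationary π Q) : stepLaw Q (stepLaw P π) = π := by
  have h1 : stepLaw P π = π := funext hP
  rw [h1]
  exact funext hQ

/-- **Exactness of the two-step noisy Monte Carlo sweep**: one `x`-move at fixed noise followed
by one noise refresh at fixed `x` leaves the extended weight `g ξ · f x ξ` invariant, and (under
unbiasedness) that weight has `X`-marginal `π`. [cite: LinLiuSloan2000, §II ("this new algorithm
does preserve detailed balance and is completely unbiased")] -/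
theorem TwoStep.exact {f : X → Ξ → ℝ} {g : Ξ → ℝ} {π : X → ℝ} (hf : ∀ x ξ, 0 < f x ξ)
    (hg : ∀ ξ, 0 < g ξ) (hunb : ∀ x, ∑ ξ, g ξ * f x ξ = π x) (T : X → X → ℝ) :
    stepLaw (TwoStep.kernelXi f g) (stepLaw (TwoStep.kernelU T f g) (target f g)) = target f g ∧
      ∀ x, ∑ ξ, target f g (x, ξ) = π x :=
  ⟨stepLaw_comp_eq (TwoStep.kernelU_isStationary hf hg T) (TwoStep.kernelXi_isStationary hf hg),
    sum_target hunb⟩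

/-! ## Signed estimators: the sign becomes part of the observable

[cite: LinLiuSloan2000, §II]: when the unbiased estimator `f(U, ξ)` of `e^{−H(U)}` can be NEGATIVE,
"one first observes that `f(U,ξ) = sign(f) |f(U,ξ)|`" (eq. (sign)); "Since sign(f) … is a state
function, we can write the expectation value of the observable `O` as
`⟨O⟩ = ∫[DU][Dξ] P_ξ(ξ) O(U) sign(f) |f(U,ξ)| / Z`" (eq. (O)); "After redefining the partition
function to be `Z = ∫[DU][Dξ] P_ξ(ξ) |f(U,ξ)|`, which is semi-positive definite" (eq. (Znew)),
"`⟨O⟩ = ⟨O(U) sign(f)⟩ / ⟨sign(f)⟩`.  As we see, the sign of `f(U,ξ)` is not a part of the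
probability any more but a part in the observable" (eq. (Onew)); the two Metropolis steps then run
on `|f|` (eqs. (met1), (met2) with `|f(U₂,ξ)|/|f(U₁,ξ)|`).  Finite form below: the `|f|`-chain is
the `TwoStep` construction above applied to `fun x ξ => |f x ξ|` (weight
`target (fun x ξ => |f x ξ|) g`, i.e. `g ξ · |f x ξ|`), and the printed identities are finite sums.
-/

namespace Signed

open SignType

omit [Fintype X] [Fintype Ξ] [DecidableEq X] [DecidableEq Ξ] in
/-- Eq. (sign) at the level of the extended weights: `(g ξ · |f x ξ|) · sign(f x ξ) = g ξ · f x ξ`.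
[cite: LinLiuSloan2000, §II eq. (sign) ("f(U,ξ) = sign(f)|f(U,ξ)|")] -/
theorem target_abs_mul_sign (f : X → Ξ → ℝ) (g : Ξ → ℝ) (z : X × Ξ) :
    target (fun x ξ => |f x ξ|) g z * (sign (f z.1 z.2) : ℝ) = target f g z := by
  show g z.2 * |f z.1 z.2| * (sign (f z.1 z.2) : ℝ) = g z.2 * f z.1 z.2
  rw [mul_assoc, abs_mul_sign]

omit [DecidableEq X] [DecidableEq Ξ] in
/-- **The numerator of eq. (Onew)**: `Σ_{(x,ξ)} g ξ |f x ξ| · (sign(f x ξ) · O x) = Σ_x π x · O x`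
for an unbiased (possibly signed) estimator `f` of `π` — eq. (O) read with the measure (Znew).
[cite: LinLiuSloan2000, §II eqs. (O), (Onew)] -/
theorem sum_absTarget_mul_sign_mul {f : X → Ξ → ℝ} {g : Ξ → ℝ} {π : X → ℝ}
    (hunb : ∀ x, ∑ ξ, g ξ * f x ξ = π x) (O : X → ℝ) :
    ∑ z : X × Ξ, target (fun x ξ => |f x ξ|) g z * ((sign (f z.1 z.2) : ℝ) * O z.1) =
      ∑ x, π x * O x := by
  rw [← sum_target_mul hunb O]
  exact sum_congr rfl fun z _ => by rw [← mul_assoc, target_abs_mul_sign]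

omit [DecidableEq X] [DecidableEq Ξ] in
/-- **The denominator of eq. (Onew)**: `Σ_{(x,ξ)} g ξ |f x ξ| · sign(f x ξ) = Σ_x π x` — the
average sign under the semi-positive measure (Znew), times its mass, is the true partition function
`Z` of eq. (Z). [cite: LinLiuSloan2000, §II eqs. (Z), (Znew), (Onew)] -/
theorem sum_absTarget_mul_sign {f : X → Ξ → ℝ} {g : Ξ → ℝ} {π : X → ℝ}
    (hunb : ∀ x, ∑ ξ, g ξ * f x ξ = π x) :
    ∑ z : X × Ξ, target (fun x ξ => |f x ξ|) g z * (sign (f z.1 z.2) : ℝ) = ∑ x, π x := by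
  simpa using sum_absTarget_mul_sign_mul hunb fun _ => (1 : ℝ)

omit [DecidableEq X] [DecidableEq Ξ] in
/-- **Sign reweighting, eq. (Onew)**: `⟨O⟩_π = ⟨O · sign(f)⟩_{|f|} / ⟨sign(f)⟩_{|f|}`, where
`⟨·⟩_{|f|}` is the expectation under the semi-positive weight `g ξ |f x ξ|` (its normalisation
cancels between numerator and denominator, so the identity is stated with the un-normalised sums).
[cite: LinLiuSloan2000, §II eq. (Onew) ("the sign of f(U,ξ) is not a part of the probability any
more but a part in the observable")] -/
theorem sign_reweighting {f : X → Ξ → ℝ} {g : Ξ → ℝ} {π : X → ℝ}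
    (hunb : ∀ x, ∑ ξ, g ξ * f x ξ = π x) (O : X → ℝ) :
    (∑ x, π x * O x) / (∑ x, π x) =
      (∑ z : X × Ξ, target (fun x ξ => |f x ξ|) g z * ((sign (f z.1 z.2) : ℝ) * O z.1)) /
        (∑ z : X × Ξ, target (fun x ξ => |f x ξ|) g z * (sign (f z.1 z.2) : ℝ)) := by
  rw [sum_absTarget_mul_sign_mul hunb O, sum_absTarget_mul_sign hunb]

omit [DecidableEq X] [DecidableEq Ξ] in
/-- The average sign is a genuine average of numbers in `[-1, 1]`: its un-normalised value is
bounded by the mass of the semi-positive measure, `|Σ π| ≤ Σ_{(x,ξ)} g ξ |f x ξ|` (for `g ≥ 0`).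
[cite: LinLiuSloan2000, §II eq. (Znew) ("semi-positive definite")] -/
theorem abs_sum_le_sum_absTarget {f : X → Ξ → ℝ} {g : Ξ → ℝ} {π : X → ℝ} (hg : ∀ ξ, 0 ≤ g ξ)
    (hunb : ∀ x, ∑ ξ, g ξ * f x ξ = π x) :
    |∑ x, π x| ≤ ∑ z : X × Ξ, target (fun x ξ => |f x ξ|) g z := by
  rw [← sum_absTarget_mul_sign hunb]
  refine (abs_sum_le_sum_abs _ _).trans (sum_le_sum fun z _ => ?_)
  have ht : 0 ≤ target (fun x ξ => |f x ξ|) g z := mul_nonneg (hg z.2) (abs_nonneg _)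
  rw [abs_mul, abs_of_nonneg ht]
  refine mul_le_of_le_one_right ht ?_
  rcases lt_trichotomy (f z.1 z.2) 0 with h | h | h <;> simp [h, sign_neg, sign_pos]

/-- **The `|f|`-chain is exact for the semi-positive weight**: the two Metropolis steps of
eqs. (met1)–(met2) run with `|f(U₂,ξ)|/|f(U₁,ξ)|` and `|f(U,ξ₂)|/|f(U,ξ₁)|` leave `g ξ · |f x ξ|`
invariant (for a nowhere-vanishing estimator), and with `sign_reweighting` the `π`-expectations are
recovered — "this new algorithm does preserve detailed balance and is completely unbiased".
[cite: LinLiuSloan2000, §II eqs. (met1), (met2) and the two detailed-balance displays] -/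
theorem abs_exact {f : X → Ξ → ℝ} {g : Ξ → ℝ} (hf : ∀ x ξ, f x ξ ≠ 0) (hg : ∀ ξ, 0 < g ξ)
    (T : X → X → ℝ) :
    IsStationary (target (fun x ξ => |f x ξ|) g) (TwoStep.kernelU T (fun x ξ => |f x ξ|) g) ∧
      IsStationary (target (fun x ξ => |f x ξ|) g) (TwoStep.kernelXi (fun x ξ => |f x ξ|) g) :=
  ⟨TwoStep.kernelU_isStationary (fun x ξ => abs_pos.mpr (hf x ξ)) hg T,
    TwoStep.kernelXi_isStationary (fun x ξ => abs_pos.mpr (hf x ξ)) hg⟩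

end Signed

end PseudoMarginal

end Literature.Probability.MarkovChains
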